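import Summits.QuantumFields.YangMills.Theorems.BalabanUVNodesN12DirectSurjHsurjSupport

/-!
# BalabanUVNodes ∕ N12 — (P4)′ IN THE ℓ¹ → ℓ¹ CURRENCY: the ROW-WISE SUPERPOSITION `H′ v := Σ_i H(v_i e_i)` of the support edition is again a right inverse, with an ℓ¹ letter
# `Σ_b ‖H′ v b‖ ≤ h·B·Σ_i ‖v_i‖` whenever every one-row hull has at most `h` bonds (the lane's `hHB1` currency, modulo the lattice count `h`)

Cell `pub-ymgap` (HUMAN RULINGS D-0062 ∕ D-0149), WIDTH SEAT `pub-ymgap-dag-n12-w6` g8 (node N12 = [B15]; key K1⁹ `stmt-QuantumFields-27364`, `--kind proof --supports … --as helper`;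
count-neutral).  THEOREMS ONLY (0 `def`, 0 `instance`, 0 `sorry`).  Sequel of `…N12DirectSurjHsurjSupport` (`exists_rightInverse_letter_support_of_proxies`: sup-norm letter + graded support
clause `hHsupp″`).  dag-n12-c g22's INTENT-1 AMENDED (2026-08-29): the (μ) row's `H`-letter of record becomes `hHB1 : Σ_b ‖(H v)_b‖ ≤ B₁ · Σ_c ‖v_c‖` (ℓ¹ → ℓ¹), «volume-free needs `H` LINEAR (or
the bound stated on one-row data and summed) + w6's per-height hull + a per-column size».

WHY.  The support edition's `H` is a `Classical.choose` per target, not linear; but the chart derivative `L = DΨ(0)` IS linear, so the ROW-WISE SUPERPOSITION `H′ v := Σ_i H(Pi.single i (v i))`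
is again a right inverse (`L(H′ v) = Σ_i L(H(v_i e_i)) = Σ_i v_i e_i = v`).  Each summand is one-row data: by `hHsupp″` it lives on ANY level-graded family closed for the single row `i`,
and by the sup-norm letter its size is `≤ B‖v_i‖`; so if every row `i` admits a closed family inside a bond set of cardinality `≤ h` (the per-height hull count — lattice geometry, NOT typed
here: DISPLAYED as the hypothesis `hhull`), then `Σ_b ‖H′ v b‖ ≤ Σ_i #T_i·B·‖v_i‖ ≤ h·B·Σ_i ‖v_i‖` — the lane's ℓ¹ → ℓ¹ letter with `B₁ := h·B`, no torus and no region cardinality.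

CONTENTS.  §1 `sum_norm_le_card_mul_norm_of_subset` (ℓ¹ over a support set ≤ its cardinality × sup).  §2 ★★★ `exists_rightInverse_l1Letter_of_proxies` — p678596's hypotheses VERBATIM ⟹
`∃ H′, (DΨ(0) ∘ H′ = id) ∧ (‖H′ v‖ ≤ B·Σ_i‖v_i‖) ∧ ∀ h, hhull(h) → ∀ v, Σ_b ‖H′ v b‖ ≤ h·B·Σ_i ‖v_i‖`, where `hhull(h)`: every row `i` has a level-graded family `𝒮` inside a finset of
`≤ h` bonds satisfying the closure (a)(b) of `hHsupp″` for the one-row charge at `i`; ★★★ `exists_rowPreimage_of_proxies` — the PER-ROW form (the inputs of the lane's socket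
`hrow_of_support_sup`, ρ6b): for a row `i`, `ξ ∈ 𝔰𝔲(N)` and a closed family inside `T`, a preimage of `Pi.single i ξ` supported in `T` with sup norm `≤ B‖ξ‖`.

HONEST FRAMING.  Bookkeeping by name over the support edition; `B` per instance (M₁, Z); the hull count `h` is a HYPOTHESIS (its per-height value is the uncommissioned U2b lattice count);
print's volume-free (46) is NOT claimed; nothing of Bałaban's asserted or refuted; N12 NOT discharged; K1⁹ NOT closed; count-neutral; R4 closes only the conditional finite-`𝕋⁴` rung
`BalabanLadder.UV`; no summit statement is proved here and NOT the Yang–Mills mass gap (Clay).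
-/

noncomputable section

open scoped BigOperators Matrix.Norms.L2Operator Topology NNReal
open Filter

namespace Summit.QuantumFields.YangMills.BalabanUVNodes.N12DirectSurjHsurjL1

open Literature.MathematicalPhysics.QuantumFieldTheory.Balaban1983to89
open Node00 B15DeterminingSets
open T4Continuum (T4Family)
open T4AdjointCovarianceUnitary (lieSU)
open B14.Eq213DetSet (Bj maxDomT)
open B14.Eq213MaximalDomains (side)
open B14.Eq216Concrete (feeds)
open B5Eq118OneStroke (iterBlockOf)
open B15Eq112TorusCover (lift)
open T4AxialGaugeSmallField (boxPlaqs)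
open Summit.QuantumFields.YangMills.BalabanUVNodes.N12DirectSurjHsurjSupport (exists_rightInverse_letter_support_of_proxies)

/-! ## §1  ℓ¹ over a support set -/

/-- `Σ_b ‖f b‖ ≤ #T · ‖f‖` when `f` vanishes off the finset `T` (sup norm on the right). [folklore] -/
theorem sum_norm_le_card_mul_norm_of_subset {α E : Type*} [Fintype α] [NormedAddCommGroup E] (f : α → E) (T : Finset α) (hf : ∀ b, b ∉ T → f b = 0) :
    ∑ b, ‖f b‖ ≤ (T.card : ℝ) * ‖f‖ := by
  classical
  have h1 : ∑ b, ‖f b‖ = ∑ b ∈ T, ‖f b‖ :=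
    (Finset.sum_subset (Finset.subset_univ T) fun b _ hb => by rw [hf b hb, norm_zero]).symm
  rw [h1]
  calc ∑ b ∈ T, ‖f b‖ ≤ ∑ _b ∈ T, ‖f‖ := Finset.sum_le_sum fun b _ => norm_le_pi_norm f b
    _ = (T.card : ℝ) * ‖f‖ := by rw [Finset.sum_const, nsmul_eq_mul]

/-! ## §2  The row-wise superposition and its ℓ¹ → ℓ¹ letter -/

section Record

variable {F : T4Family} {N : ℕ} [NeZero N] {K k : ℕ}

/-- ★★★ **(P4)′ IN THE ℓ¹ → ℓ¹ CURRENCY.**  Under p678596's hypotheses VERBATIM (`k + 1 ≤ m + K`; `ε > 0` per height; per `M₁ ≥ 1`, `Z` with (2.13)'s divisibility the sup-norm letter `B ≥ 0`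
of the support edition; fibre condition, proxies `hprox`∕`hproxSite`, box plaquette letter): a right inverse `H′` of `DΨ_{𝐁_k(Z),W,U₀}(0)` — the row-wise superposition of the support
edition's `H` — with `‖H′ v‖ ≤ B·Σ_i ‖v_i‖` and, for every `h` such that EVERY row `i` admits a level-graded family `𝒮` inside a finset of at most `h` bonds that is closed for the one-row
charge at `i` ((a) the row itself if it is a level-`0` row; (b) the internal-face bonds of the `j`-blocks of the inner end-points of every level-`j` row which IS the row `i` or whose sharp
tower meets a lower grade), the ℓ¹ → ℓ¹ letter `Σ_b ‖H′ v b‖ ≤ h·B·Σ_i ‖v_i‖`. [cite: Balaban1985Variational, (83) p.290, (44)-(47) p.285; Balaban1988Convergent, (2.10)-(2.13) pp.256-257;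
Balaban1987RG1, (0.4) p.253] -/
theorem exists_rightInverse_l1Letter_of_proxies (hkK : k + 1 ≤ (F.P K).m + (F.P K).K) :
    ∃ ε : ℝ, 0 < ε ∧ ∀ (M₁ : ℕ) (_ : 1 ≤ M₁) (Z : Set (Site (F.P K) 0)) (_ : side (F.P K).L M₁ k ∣ (F.P K).sitesPerDir 0),
      ∃ B : ℝ, 0 ≤ B ∧ ∀ (W : MSField (F.P K) (SU N)) (U₀ : GaugeField (F.P K) 0 (SU N)),
        AgreeOn (Bj M₁ Z k) (avgFamily (avOfRecord F N K) U₀) W →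
        (∀ i : Fin (constrCard (Bj M₁ Z k) k), ∃ U' : GaugeField (F.P K) 0 (SU N),
          (∀ b ∈ feeds (((constrEnum (Bj M₁ Z k) k).symm i).1 : ℕ) ((constrEnum (Bj M₁ Z k) k).symm i).2.1, U' b = U₀ b) ∧ SmallBelow (avOfRecord F N K) k U') →
        (∀ (j : ℕ), 1 ≤ j → j ≤ k → ∀ y : Site (F.P K) j, embIter j y ∈ maxDomT M₁ Z j → ∃ U' : GaugeField (F.P K) 0 (SU N),
          (∀ c : PBond (F.P K) j, (c.src = y ∨ c.tgt = y) → ∀ b₀ : PBond (F.P K) 0,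
            (iterBlockOf j b₀.src = c.src ∨ iterBlockOf j b₀.src = c.tgt) → (iterBlockOf j b₀.tgt = c.src ∨ iterBlockOf j b₀.tgt = c.tgt) → U' b₀ = U₀ b₀) ∧
          SmallBelow (avOfRecord F N K) k U') →
        (∀ (j : ℕ), 1 ≤ j → j ≤ k → ∀ y : Site (F.P K) j, embIter j y ∈ maxDomT M₁ Z j →
          PlaqSmallOn (boxPlaqs (P := F.P K) (j := 0)
            (fun κ => lift (F.P K) (embIter j y) κ - ((((F.P K).L ^ j : ℕ) : ℤ) + ((((F.P K).L ^ j - 1) / 2 : ℕ) : ℤ)))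
            (fun κ => lift (F.P K) (embIter j y) κ + ((((F.P K).L ^ j : ℕ) : ℤ) + ((((F.P K).L ^ j - 1) / 2 : ℕ) : ℤ)))) ε U₀) →
        ∃ H : (Fin (constrCard (Bj M₁ Z k) k) → lieSU (Fin N)) → PBond (F.P K) 0 → lieSU (Fin N),
          (∀ v, fderiv ℝ (msChart F N K k (Bj M₁ Z k) W U₀) 0 (H v) = v) ∧
          (∀ v, ‖H v‖ ≤ B * ∑ i, ‖v i‖) ∧
          ∀ (h : ℕ), (∀ i : Fin (constrCard (Bj M₁ Z k) k), ∃ (𝒮 : ℕ → Set (PBond (F.P K) 0)) (T : Finset (PBond (F.P K) 0)),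
              (∀ m, ∀ b ∈ 𝒮 m, b ∈ T) ∧ T.card ≤ h ∧
              (∀ (b : PBond (F.P K) 0) (hb : b ∈ bondsOf (Bj M₁ Z k 0)), constrEnum (Bj M₁ Z k) k ⟨⟨0, Nat.succ_pos k⟩, b, hb⟩ = i → b ∈ 𝒮 0) ∧
              (∀ (j : ℕ) (hj : 1 ≤ j) (hjk : j ≤ k) (c : PBond (F.P K) j) (hc : c ∈ bondsOf (Bj M₁ Z k j)),
                (constrEnum (Bj M₁ Z k) k ⟨⟨j, Nat.lt_succ_of_le hjk⟩, c, hc⟩ = i ∨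
                  ∃ m, m < j ∧ ∃ b₀ ∈ 𝒮 m, (iterBlockOf j b₀.src = c.src ∨ iterBlockOf j b₀.src = c.tgt) ∧ (iterBlockOf j b₀.tgt = c.src ∨ iterBlockOf j b₀.tgt = c.tgt)) →
                ∀ y : Site (F.P K) j, (c.src = y ∨ c.tgt = y) → embIter j y ∈ maxDomT M₁ Z j →
                ∀ b₀ : PBond (F.P K) 0, iterBlockOf j b₀.src = y → iterBlockOf j b₀.tgt = y → iterBlockOf (j - 1) b₀.src ≠ iterBlockOf (j - 1) b₀.tgt → b₀ ∈ 𝒮 j)) →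
            ∀ v, ∑ b, ‖H v b‖ ≤ h * B * ∑ i, ‖v i‖ := by
  classical
  obtain ⟨ε, hε, hmain⟩ := exists_rightInverse_letter_support_of_proxies (F := F) (N := N) (K := K) (k := k) hkK
  refine ⟨ε, hε, fun M₁ hM1 Z hdiv => ?_⟩
  obtain ⟨B, hB0, hB⟩ := hmain M₁ hM1 Z hdiv
  refine ⟨B, hB0, fun W U₀ hU hprox hproxSite hplaq => ?_⟩
  obtain ⟨H, hHinv, hHsup, _, hHsupp⟩ := hB W U₀ hU hprox hproxSite hplaq
  -- the one-row charges and their sup norms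
  have hns : ∀ (v : Fin (constrCard (Bj M₁ Z k) k) → lieSU (Fin N)) (i : Fin (constrCard (Bj M₁ Z k) k)),
      ‖Pi.single (M := fun _ => lieSU (Fin N)) i (v i)‖ ≤ ‖v i‖ := fun v i =>
    (pi_norm_le_iff_of_nonneg (norm_nonneg _)).2 fun i' => by
      by_cases hi : i' = i
      · subst hi; rw [Pi.single_eq_same]
      · rw [Pi.single_eq_of_ne hi, norm_zero]; exact norm_nonneg _
  -- the row-wise superposition
  refine ⟨fun v => ∑ i, H (Pi.single i (v i)), fun v => ?_, fun v => ?_, fun h hhull v => ?_⟩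
  · -- right inverse: `L` is linear
    rw [map_sum]
    simp_rw [hHinv]
    exact Finset.univ_sum_single v
  · -- sup letter
    calc ‖∑ i, H (Pi.single i (v i))‖ ≤ ∑ i, ‖H (Pi.single i (v i))‖ := norm_sum_le _ _
      _ ≤ ∑ i, B * ‖v i‖ := Finset.sum_le_sum fun i _ => (hHsup _).trans (mul_le_mul_of_nonneg_left (hns v i) hB0)
      _ = B * ∑ i, ‖v i‖ := by rw [Finset.mul_sum]
  · -- ℓ¹ → ℓ¹ letter: each one-row summand lives on its hull (`hHsupp″`) and has size `≤ B‖v_i‖`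
    have hrow : ∀ i : Fin (constrCard (Bj M₁ Z k) k), ∑ b, ‖H (Pi.single i (v i)) b‖ ≤ h * (B * ‖v i‖) := by
      intro i
      obtain ⟨𝒮, T, hT, hTh, ha, hb⟩ := hhull i
      -- the one-row charge at `i` satisfies the closure hypotheses of `hHsupp″` for `𝒮`
      have hne : ∀ i', Pi.single (M := fun _ => lieSU (Fin N)) i (v i) i' ≠ 0 → i' = i := fun i' hi' => by
        by_contra hii
        exact hi' (Pi.single_eq_of_ne hii _)
      have hzero : ∀ b, b ∉ T → H (Pi.single i (v i)) b = 0 := fun b hbT =>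
        hHsupp (Pi.single i (v i)) 𝒮 (fun b' hb' hv => ha b' hb' (hne _ hv))
          (fun j hj hjk c hc hc' y hy hin b₀ hs ht hf => hb j hj hjk c hc (hc'.imp (fun hv => hne _ hv) id) y hy hin b₀ hs ht hf)
          b fun m hm => hbT (hT m b hm)
      calc ∑ b, ‖H (Pi.single i (v i)) b‖ ≤ (T.card : ℝ) * ‖H (Pi.single i (v i))‖ := sum_norm_le_card_mul_norm_of_subset _ T hzero
        _ ≤ h * (B * ‖v i‖) :=
            mul_le_mul (by exact_mod_cast hTh) ((hHsup _).trans (mul_le_mul_of_nonneg_left (hns v i) hB0)) (norm_nonneg _) (Nat.cast_nonneg _)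
    calc ∑ b, ‖(∑ i, H (Pi.single i (v i))) b‖ = ∑ b, ‖∑ i, H (Pi.single i (v i)) b‖ := by simp_rw [Finset.sum_apply]
      _ ≤ ∑ b, ∑ i, ‖H (Pi.single i (v i)) b‖ := Finset.sum_le_sum fun b _ => norm_sum_le _ _
      _ = ∑ i, ∑ b, ‖H (Pi.single i (v i)) b‖ := Finset.sum_comm
      _ ≤ ∑ i, h * (B * ‖v i‖) := Finset.sum_le_sum fun i _ => hrow i
      _ = h * B * ∑ i, ‖v i‖ := by rw [Finset.mul_sum]; simp_rw [mul_assoc]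

/-- ★★★ **THE PER-ROW PREIMAGE LETTER** (the inputs of the lane's per-height socket `hrow_of_support_sup`, dag-n12-c g22 INTENT-3 ρ6b, 2026-08-29): under p678596's hypotheses VERBATIM, with
the sup-norm letter `B` of the support edition: for every row `i`, every `ξ ∈ 𝔰𝔲(N)` and every level-graded family `𝒮` inside a finset `T` that is closed for the one-row charge at `i`
(clauses (a)(b) of `hHsupp″` with «charged» = «is the row `i`»), a preimage `x` of `Pi.single i ξ` under `DΨ_{𝐁_k(Z),W,U₀}(0)` supported in `T` with `‖x‖ ≤ B‖ξ‖` (namely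
`x := H (Pi.single i ξ)`).  With a per-height count `#T ≤ h` this is `hrow` at `B₁ := h·B`. [cite: Balaban1985Variational, (83) p.290, (44)-(47) p.285; Balaban1988Convergent, (2.10)-(2.13)
pp.256-257; Balaban1987RG1, (0.4) p.253] -/
theorem exists_rowPreimage_of_proxies (hkK : k + 1 ≤ (F.P K).m + (F.P K).K) :
    ∃ ε : ℝ, 0 < ε ∧ ∀ (M₁ : ℕ) (_ : 1 ≤ M₁) (Z : Set (Site (F.P K) 0)) (_ : side (F.P K).L M₁ k ∣ (F.P K).sitesPerDir 0),
      ∃ B : ℝ, 0 ≤ B ∧ ∀ (W : MSField (F.P K) (SU N)) (U₀ : GaugeField (F.P K) 0 (SU N)),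
        AgreeOn (Bj M₁ Z k) (avgFamily (avOfRecord F N K) U₀) W →
        (∀ i : Fin (constrCard (Bj M₁ Z k) k), ∃ U' : GaugeField (F.P K) 0 (SU N),
          (∀ b ∈ feeds (((constrEnum (Bj M₁ Z k) k).symm i).1 : ℕ) ((constrEnum (Bj M₁ Z k) k).symm i).2.1, U' b = U₀ b) ∧ SmallBelow (avOfRecord F N K) k U') →
        (∀ (j : ℕ), 1 ≤ j → j ≤ k → ∀ y : Site (F.P K) j, embIter j y ∈ maxDomT M₁ Z j → ∃ U' : GaugeField (F.P K) 0 (SU N),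
          (∀ c : PBond (F.P K) j, (c.src = y ∨ c.tgt = y) → ∀ b₀ : PBond (F.P K) 0,
            (iterBlockOf j b₀.src = c.src ∨ iterBlockOf j b₀.src = c.tgt) → (iterBlockOf j b₀.tgt = c.src ∨ iterBlockOf j b₀.tgt = c.tgt) → U' b₀ = U₀ b₀) ∧
          SmallBelow (avOfRecord F N K) k U') →
        (∀ (j : ℕ), 1 ≤ j → j ≤ k → ∀ y : Site (F.P K) j, embIter j y ∈ maxDomT M₁ Z j →
          PlaqSmallOn (boxPlaqs (P := F.P K) (j := 0)
            (fun κ => lift (F.P K) (embIter j y) κ - ((((F.P K).L ^ j : ℕ) : ℤ) + ((((F.P K).L ^ j - 1) / 2 : ℕ) : ℤ)))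
            (fun κ => lift (F.P K) (embIter j y) κ + ((((F.P K).L ^ j : ℕ) : ℤ) + ((((F.P K).L ^ j - 1) / 2 : ℕ) : ℤ)))) ε U₀) →
        ∀ (i : Fin (constrCard (Bj M₁ Z k) k)) (ξ : lieSU (Fin N)) (𝒮 : ℕ → Set (PBond (F.P K) 0)) (T : Finset (PBond (F.P K) 0)),
          (∀ m, ∀ b ∈ 𝒮 m, b ∈ T) →
          (∀ (b : PBond (F.P K) 0) (hb : b ∈ bondsOf (Bj M₁ Z k 0)), constrEnum (Bj M₁ Z k) k ⟨⟨0, Nat.succ_pos k⟩, b, hb⟩ = i → b ∈ 𝒮 0) →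
          (∀ (j : ℕ) (hj : 1 ≤ j) (hjk : j ≤ k) (c : PBond (F.P K) j) (hc : c ∈ bondsOf (Bj M₁ Z k j)),
            (constrEnum (Bj M₁ Z k) k ⟨⟨j, Nat.lt_succ_of_le hjk⟩, c, hc⟩ = i ∨
              ∃ m, m < j ∧ ∃ b₀ ∈ 𝒮 m, (iterBlockOf j b₀.src = c.src ∨ iterBlockOf j b₀.src = c.tgt) ∧ (iterBlockOf j b₀.tgt = c.src ∨ iterBlockOf j b₀.tgt = c.tgt)) →
            ∀ y : Site (F.P K) j, (c.src = y ∨ c.tgt = y) → embIter j y ∈ maxDomT M₁ Z j →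
            ∀ b₀ : PBond (F.P K) 0, iterBlockOf j b₀.src = y → iterBlockOf j b₀.tgt = y → iterBlockOf (j - 1) b₀.src ≠ iterBlockOf (j - 1) b₀.tgt → b₀ ∈ 𝒮 j) →
          ∃ x : PBond (F.P K) 0 → lieSU (Fin N),
            fderiv ℝ (msChart F N K k (Bj M₁ Z k) W U₀) 0 x = Pi.single i ξ ∧ (∀ b, b ∉ T → x b = 0) ∧ ‖x‖ ≤ B * ‖ξ‖ := by
  classical
  obtain ⟨ε, hε, hmain⟩ := exists_rightInverse_letter_support_of_proxies (F := F) (N := N) (K := K) (k := k) hkK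
  refine ⟨ε, hε, fun M₁ hM1 Z hdiv => ?_⟩
  obtain ⟨B, hB0, hB⟩ := hmain M₁ hM1 Z hdiv
  refine ⟨B, hB0, fun W U₀ hU hprox hproxSite hplaq i ξ 𝒮 T hT ha hb => ?_⟩
  obtain ⟨H, hHinv, hHsup, _, hHsupp⟩ := hB W U₀ hU hprox hproxSite hplaq
  have hne : ∀ i', Pi.single (M := fun _ => lieSU (Fin N)) i ξ i' ≠ 0 → i' = i := fun i' hi' => by
    by_contra hii
    exact hi' (Pi.single_eq_of_ne hii _)
  have hns : ‖Pi.single (M := fun _ => lieSU (Fin N)) i ξ‖ ≤ ‖ξ‖ := (pi_norm_le_iff_of_nonneg (norm_nonneg _)).2 fun i' => by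
    by_cases hi : i' = i
    · subst hi; rw [Pi.single_eq_same]
    · rw [Pi.single_eq_of_ne hi, norm_zero]; exact norm_nonneg _
  refine ⟨H (Pi.single i ξ), hHinv _, fun b hbT => ?_, (hHsup _).trans (mul_le_mul_of_nonneg_left hns hB0)⟩
  exact hHsupp (Pi.single i ξ) 𝒮 (fun b' hb' hv => ha b' hb' (hne _ hv))
    (fun j hj hjk c hc hc' y hy hin b₀ hs ht hf => hb j hj hjk c hc (hc'.imp (fun hv => hne _ hv) id) y hy hin b₀ hs ht hf) b fun m hm => hbT (hT m b hm)

end Record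

end Summit.QuantumFields.YangMills.BalabanUVNodes.N12DirectSurjHsurjL1

end
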